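import Mathlib.GroupTheory.SpecificGroups.Cyclic
import Mathlib.Tactic.Linarith
import HarnessLib

/-!
# Near-tilings by two translates with defect two: at most two cosets

ω-census, family (b3).  Framing: lottery ticket; floor = certified bounds/negative ranges.

Two variants of `CyclicOfNearTiling.zmultiples_eq_top_of_near_tiling` (finite abelian `A`, `d ∈ A`, `P, C ⊆ A`):

* `two_cosets_of_near_tiling_two`: `A = P ⊔ (P + d) ⊔ C`, `C ∩ (C + d) = ∅`, `|P| = |C| + 2` ⟹ `A` is the union
  of at most two cosets of `⟨d⟩` (`c ↦ c + d` maps `C` into `P` missing two points; a coset of `⟨d⟩` avoiding both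
  would have size `≡ 0 (mod 3)` while the coset of a missed point has size `≢ 0`).
* `two_cosets_of_near_tiling_hole`: `A = P ⊔ (P + d) ⊔ C ⊔ {η}`, `C ∩ (C + d) = ∅`, `|P| = |C|` ⟹ at most two
  cosets of `⟨d⟩` (`C + d ⊆ P ∪ {η}` misses one point `μ`; every coset contains `η` or `μ`).

These are the combinatorial cores of "a TPP triple of pattern `(2, 2, 2q)` attains the dihedral-like law
`(8|A| − 8)/3` (`|A| ≡ 1 (mod 3)`) only if `A` has a cyclic subgroup of index `≤ 2`"
(`DihedralLawModOneTwoCosets.lean`).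
-/

namespace Summit.MatrixMultiplication.OmegaCensus

open Finset

section NearTiling

variable {A : Type*} [AddCommGroup A] [Fintype A] [DecidableEq A]

/-- **Defect two: at most two cosets of `⟨d⟩`.** [folklore] -/
theorem two_cosets_of_near_tiling_two {P C : Finset A} {d : A}
    (hPC : Disjoint P C) (hPdC : Disjoint (P.image fun x => x + d) C)
    (hcov : P ∪ P.image (fun x => x + d) ∪ C = univ)
    (hCC : Disjoint C (C.image fun x => x + d)) (hcard : P.card = C.card + 2)
    (hPP : Disjoint P (P.image fun x => x + d)) :
    ∃ a b : A, ∀ x : A, x - a ∈ AddSubgroup.zmultiples d ∨ x - b ∈ AddSubgroup.zmultiples d := by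
  classical
  set D := AddSubgroup.zmultiples d with hDdef
  have hdD : d ∈ D := AddSubgroup.mem_zmultiples d
  have memA : ∀ x : A, x ∈ P ∨ x ∈ P.image (fun x => x + d) ∨ x ∈ C := by
    intro x
    have hx : x ∈ P ∪ P.image (fun x => x + d) ∪ C := by rw [hcov]; exact mem_univ x
    simpa [mem_union, or_assoc] using hx
  have hCP : ∀ c ∈ C, c + d ∈ P := by
    intro c hc
    rcases memA (c + d) with h | h | h
    · exact h
    · obtain ⟨p, hp, hpe⟩ := mem_image.1 h
      have : p = c := add_right_cancel hpe
      subst this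
      exact absurd hc (disjoint_left.1 hPC hp)
    · exact absurd (mem_image_of_mem (fun x => x + d) hc) (disjoint_left.1 hCC h)
  -- the image `C + d ⊆ P` misses exactly two points: `M`
  have himg : C.image (fun x => x + d) ⊆ P := image_subset_iff.2 hCP
  have hcimg : (C.image fun x => x + d).card = C.card := card_image_of_injective _ (add_left_injective d)
  set M := P \ C.image (fun x => x + d) with hMdef
  have hM2 : M.card = 2 := by rw [hMdef, card_sdiff_of_subset himg, hcimg, hcard]; omega
  obtain ⟨p₁, p₂, hp12, hM⟩ := card_eq_two.1 hM2
  have hMP : M ⊆ P := sdiff_subset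
  have hPre : ∀ p ∈ P, p ∉ M → ∃ c ∈ C, c + d = p := by
    intro p hp hne
    by_contra hnot
    exact hne (mem_sdiff.2 ⟨hp, fun h => hnot (by simpa using mem_image.1 h)⟩)
  -- cosets of `D` as finsets; all have the size of `D`
  have Kcard : ∀ x : A, (univ.filter fun y => y - x ∈ D).card = (univ.filter fun y => y ∈ D).card := by
    intro x
    have hK : (univ.filter fun y => y ∈ D).image (fun y => y + x) = univ.filter fun y => y - x ∈ D := by
      ext y
      simp only [mem_image, mem_filter, mem_univ, true_and]
      constructor
      · rintro ⟨z, hz, rfl⟩; simpa using hz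
      · intro hy; exact ⟨y - x, hy, sub_add_cancel y x⟩
    rw [← hK, card_image_of_injective _ (add_left_injective x)]
  have shiftD : ∀ x y : A, y - x ∈ D → y + d - x ∈ D := fun x y h => by
    have := D.add_mem h hdD; rwa [sub_add_eq_add_sub] at this
  have shiftD' : ∀ x y : A, y - x ∈ D → y - d - x ∈ D := fun x y h => by
    have := D.sub_mem h hdD; rwa [sub_right_comm] at this
  have Kdecomp : ∀ x : A, (univ.filter fun y => y - x ∈ D).card =
      (P.filter fun y => y - x ∈ D).card + ((P.image fun x => x + d).filter fun y => y - x ∈ D).card +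
        (C.filter fun y => y - x ∈ D).card := by
    intro x
    rw [← hcov, filter_union, filter_union,
      card_union_of_disjoint (disjoint_union_left.2 ⟨disjoint_filter_filter hPC, disjoint_filter_filter hPdC⟩),
      card_union_of_disjoint (disjoint_filter_filter hPP)]
  have KPd : ∀ x : A, ((P.image fun x => x + d).filter fun y => y - x ∈ D).card =
      (P.filter fun y => y - x ∈ D).card := by
    intro x
    have hEq : (P.filter fun y => y - x ∈ D).image (fun y => y + d) =
        (P.image fun x => x + d).filter fun y => y - x ∈ D := by
      ext y
      simp only [mem_image, mem_filter]
      constructor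
      · rintro ⟨p, ⟨hp, hpD⟩, rfl⟩; exact ⟨⟨p, hp, rfl⟩, shiftD x p hpD⟩
      · rintro ⟨⟨p, hp, rfl⟩, hD⟩
        exact ⟨p, ⟨hp, by have := shiftD' x (p + d) hD; rwa [add_sub_cancel_right] at this⟩, rfl⟩
    rw [← hEq, card_image_of_injective _ (add_left_injective d)]
  -- `|C ∩ K| + |M ∩ K| = |P ∩ K|` for every coset `K`
  have KCM : ∀ x : A, (C.filter fun y => y - x ∈ D).card + (M.filter fun y => y - x ∈ D).card =
      (P.filter fun y => y - x ∈ D).card := by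
    intro x
    have hEq : (C.filter fun y => y - x ∈ D).image (fun y => y + d) ∪ (M.filter fun y => y - x ∈ D) =
        P.filter fun y => y - x ∈ D := by
      ext y
      simp only [mem_union, mem_image, mem_filter]
      constructor
      · rintro (⟨c, ⟨hc, hcD⟩, rfl⟩ | ⟨hyM, hyD⟩)
        · exact ⟨hCP c hc, shiftD x c hcD⟩
        · exact ⟨hMP hyM, hyD⟩
      · rintro ⟨hy, hyD⟩
        by_cases hyM : y ∈ M
        · exact Or.inr ⟨hyM, hyD⟩
        · obtain ⟨c, hc, rfl⟩ := hPre y hy hyM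
          exact Or.inl ⟨c, ⟨hc, by have := shiftD' x (c + d) hyD; rwa [add_sub_cancel_right] at this⟩, rfl⟩
    have hdis : Disjoint ((C.filter fun y => y - x ∈ D).image (fun y => y + d)) (M.filter fun y => y - x ∈ D) := by
      rw [disjoint_left]
      rintro y hy hyM
      obtain ⟨c, hc, rfl⟩ := mem_image.1 hy
      have : c + d ∈ C.image (fun x => x + d) := mem_image_of_mem _ (mem_filter.1 hc).1
      exact (mem_sdiff.1 (mem_filter.1 hyM).1).2 this
    rw [← hEq, card_union_of_disjoint hdis, card_image_of_injective _ (add_left_injective d)]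
  -- every coset meets `M`
  have hmeet : ∀ x : A, 1 ≤ (M.filter fun y => y - x ∈ D).card := by
    intro x
    by_contra h0
    have h0' : (M.filter fun y => y - x ∈ D).card = 0 := by omega
    have h1 := Kdecomp x
    have h2 := Kdecomp p₁
    have m1 := KCM x
    have m2 := KCM p₁
    rw [KPd x, Kcard x] at h1
    rw [KPd p₁, Kcard p₁] at h2
    have hp₁M : p₁ ∈ M.filter fun y => y - p₁ ∈ D := mem_filter.2 ⟨by rw [hM]; simp, by rw [sub_self]; exact D.zero_mem⟩
    have hge : 1 ≤ (M.filter fun y => y - p₁ ∈ D).card := card_pos.2 ⟨p₁, hp₁M⟩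
    have hle : (M.filter fun y => y - p₁ ∈ D).card ≤ 2 := (card_le_card (filter_subset _ M)).trans hM2.le
    omega
  refine ⟨p₁, p₂, fun x => ?_⟩
  obtain ⟨y, hy⟩ := card_pos.1 (hmeet x)
  rw [mem_filter, hM, mem_insert, mem_singleton] at hy
  rcases hy with ⟨rfl | rfl, hyD⟩
  · left; have := D.neg_mem hyD; rwa [neg_sub] at this
  · right; have := D.neg_mem hyD; rwa [neg_sub] at this

/-- **One hole, equal sizes: at most two cosets of `⟨d⟩`.** [folklore] -/
theorem two_cosets_of_near_tiling_hole {P C : Finset A} {d η : A}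
    (hPC : Disjoint P C) (hPdC : Disjoint (P.image fun x => x + d) C)
    (hPP : Disjoint P (P.image fun x => x + d))
    (hηP : η ∉ P) (hηPd : η ∉ P.image (fun x => x + d)) (hηC : η ∉ C)
    (hcov : P ∪ P.image (fun x => x + d) ∪ C ∪ {η} = univ)
    (hCC : Disjoint C (C.image fun x => x + d)) (hcard : P.card = C.card) :
    ∃ a b : A, ∀ x : A, x - a ∈ AddSubgroup.zmultiples d ∨ x - b ∈ AddSubgroup.zmultiples d := by
  classical
  set D := AddSubgroup.zmultiples d with hDdef
  have hdD : d ∈ D := AddSubgroup.mem_zmultiples d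
  have memA : ∀ x : A, x ∈ P ∪ P.image (fun x => x + d) ∪ C ∪ {η} := by
    intro x; rw [hcov]; exact mem_univ x
  set Q := insert η P with hQdef
  have hCQ : ∀ c ∈ C, c + d ∈ Q := by
    intro c hc
    have h4 := memA (c + d)
    simp only [mem_union, mem_singleton] at h4
    rcases h4 with ((h | h) | h) | h
    · exact mem_insert_of_mem h
    · obtain ⟨p, hp, hpe⟩ := mem_image.1 h
      have : p = c := add_right_cancel hpe
      subst this
      exact absurd hc (disjoint_left.1 hPC hp)
    · exact absurd (mem_image_of_mem (fun x => x + d) hc) (disjoint_left.1 hCC h)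
    · rw [h]; exact mem_insert_self η P
  have himg : C.image (fun x => x + d) ⊆ Q := image_subset_iff.2 hCQ
  have hcimg : (C.image fun x => x + d).card = C.card := card_image_of_injective _ (add_left_injective d)
  have hQcard : Q.card = P.card + 1 := by rw [hQdef, card_insert_of_notMem hηP]
  set M := Q \ C.image (fun x => x + d) with hMdef
  have hM1 : M.card = 1 := by rw [hMdef, card_sdiff_of_subset himg, hcimg, hQcard, hcard]; omega
  obtain ⟨μ, hM⟩ := card_eq_one.1 hM1
  have hMQ : M ⊆ Q := sdiff_subset
  have hPre : ∀ p ∈ Q, p ∉ M → ∃ c ∈ C, c + d = p := by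
    intro p hp hne
    by_contra hnot
    exact hne (mem_sdiff.2 ⟨hp, fun h => hnot (by simpa using mem_image.1 h)⟩)
  have Kcard : ∀ x : A, (univ.filter fun y => y - x ∈ D).card = (univ.filter fun y => y ∈ D).card := by
    intro x
    have hK : (univ.filter fun y => y ∈ D).image (fun y => y + x) = univ.filter fun y => y - x ∈ D := by
      ext y
      simp only [mem_image, mem_filter, mem_univ, true_and]
      constructor
      · rintro ⟨z, hz, rfl⟩; simpa using hz
      · intro hy; exact ⟨y - x, hy, sub_add_cancel y x⟩
    rw [← hK, card_image_of_injective _ (add_left_injective x)]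
  have shiftD : ∀ x y : A, y - x ∈ D → y + d - x ∈ D := fun x y h => by
    have := D.add_mem h hdD; rwa [sub_add_eq_add_sub] at this
  have shiftD' : ∀ x y : A, y - x ∈ D → y - d - x ∈ D := fun x y h => by
    have := D.sub_mem h hdD; rwa [sub_right_comm] at this
  have dPE : Disjoint P ({η} : Finset A) := disjoint_singleton_right.2 hηP
  have dPdE : Disjoint (P.image fun x => x + d) ({η} : Finset A) := disjoint_singleton_right.2 hηPd
  have dCE : Disjoint C ({η} : Finset A) := disjoint_singleton_right.2 hηC
  have Kdecomp : ∀ x : A, (univ.filter fun y => y - x ∈ D).card =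
      (P.filter fun y => y - x ∈ D).card + ((P.image fun x => x + d).filter fun y => y - x ∈ D).card +
        (C.filter fun y => y - x ∈ D).card + (({η} : Finset A).filter fun y => y - x ∈ D).card := by
    intro x
    rw [← hcov, filter_union, filter_union, filter_union,
      card_union_of_disjoint (disjoint_union_left.2 ⟨disjoint_union_left.2
        ⟨disjoint_filter_filter dPE, disjoint_filter_filter dPdE⟩, disjoint_filter_filter dCE⟩),
      card_union_of_disjoint (disjoint_union_left.2 ⟨disjoint_filter_filter hPC, disjoint_filter_filter hPdC⟩),
      card_union_of_disjoint (disjoint_filter_filter hPP)]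
  have KPd : ∀ x : A, ((P.image fun x => x + d).filter fun y => y - x ∈ D).card =
      (P.filter fun y => y - x ∈ D).card := by
    intro x
    have hEq : (P.filter fun y => y - x ∈ D).image (fun y => y + d) =
        (P.image fun x => x + d).filter fun y => y - x ∈ D := by
      ext y
      simp only [mem_image, mem_filter]
      constructor
      · rintro ⟨p, ⟨hp, hpD⟩, rfl⟩; exact ⟨⟨p, hp, rfl⟩, shiftD x p hpD⟩
      · rintro ⟨⟨p, hp, rfl⟩, hD⟩
        exact ⟨p, ⟨hp, by have := shiftD' x (p + d) hD; rwa [add_sub_cancel_right] at this⟩, rfl⟩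
    rw [← hEq, card_image_of_injective _ (add_left_injective d)]
  -- `|Q ∩ K| = |P ∩ K| + |{η} ∩ K|`
  have KQ : ∀ x : A, (Q.filter fun y => y - x ∈ D).card =
      (P.filter fun y => y - x ∈ D).card + (({η} : Finset A).filter fun y => y - x ∈ D).card := by
    intro x
    rw [hQdef, insert_eq, filter_union,
      card_union_of_disjoint (disjoint_filter_filter (disjoint_singleton_left.2 hηP)), add_comm]
  -- `|C ∩ K| + |M ∩ K| = |Q ∩ K|`
  have KCM : ∀ x : A, (C.filter fun y => y - x ∈ D).card + (M.filter fun y => y - x ∈ D).card =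
      (Q.filter fun y => y - x ∈ D).card := by
    intro x
    have hEq : (C.filter fun y => y - x ∈ D).image (fun y => y + d) ∪ (M.filter fun y => y - x ∈ D) =
        Q.filter fun y => y - x ∈ D := by
      ext y
      simp only [mem_union, mem_image, mem_filter]
      constructor
      · rintro (⟨c, ⟨hc, hcD⟩, rfl⟩ | ⟨hyM, hyD⟩)
        · exact ⟨hCQ c hc, shiftD x c hcD⟩
        · exact ⟨hMQ hyM, hyD⟩
      · rintro ⟨hy, hyD⟩
        by_cases hyM : y ∈ M
        · exact Or.inr ⟨hyM, hyD⟩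
        · obtain ⟨c, hc, rfl⟩ := hPre y hy hyM
          exact Or.inl ⟨c, ⟨hc, by have := shiftD' x (c + d) hyD; rwa [add_sub_cancel_right] at this⟩, rfl⟩
    have hdis : Disjoint ((C.filter fun y => y - x ∈ D).image (fun y => y + d)) (M.filter fun y => y - x ∈ D) := by
      rw [disjoint_left]
      rintro y hy hyM
      obtain ⟨c, hc, rfl⟩ := mem_image.1 hy
      have : c + d ∈ C.image (fun x => x + d) := mem_image_of_mem _ (mem_filter.1 hc).1
      exact (mem_sdiff.1 (mem_filter.1 hyM).1).2 this
    rw [← hEq, card_union_of_disjoint hdis, card_image_of_injective _ (add_left_injective d)]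
  -- every coset contains `η` or `μ`
  have hmeet : ∀ x : A, 1 ≤ (({η} : Finset A).filter fun y => y - x ∈ D).card +
      (M.filter fun y => y - x ∈ D).card := by
    intro x
    by_contra h0
    have hE0 : (({η} : Finset A).filter fun y => y - x ∈ D).card = 0 := by omega
    have hM0 : (M.filter fun y => y - x ∈ D).card = 0 := by omega
    have h1 := Kdecomp x
    have h2 := Kdecomp η
    have m1 := KCM x
    have m2 := KCM η
    have q1 := KQ x
    have q2 := KQ η
    rw [KPd x, Kcard x] at h1
    rw [KPd η, Kcard η] at h2
    have hE1 : (({η} : Finset A).filter fun y => y - η ∈ D).card = 1 := by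
      rw [filter_singleton, if_pos (by rw [sub_self]; exact D.zero_mem), card_singleton]
    have hle : (M.filter fun y => y - η ∈ D).card ≤ 1 := (card_le_card (filter_subset _ M)).trans hM1.le
    omega
  refine ⟨η, μ, fun x => ?_⟩
  have hx := hmeet x
  by_cases hE : (({η} : Finset A).filter fun y => y - x ∈ D).card = 0
  · rw [hE, zero_add] at hx
    obtain ⟨y, hy⟩ := card_pos.1 hx
    rw [mem_filter, hM, mem_singleton] at hy
    obtain ⟨rfl, hyD⟩ := hy
    right; have := D.neg_mem hyD; rwa [neg_sub] at this
  · obtain ⟨y, hy⟩ := card_pos.1 (Nat.pos_of_ne_zero hE)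
    rw [mem_filter, mem_singleton] at hy
    obtain ⟨rfl, hyD⟩ := hy
    left; have := D.neg_mem hyD; rwa [neg_sub] at this

end NearTiling

end Summit.MatrixMultiplication.OmegaCensus
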